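/-
Copyright (c) 2026 the pub-hodgecm-mathlib formalisation cell (harness21).  Prover seat hodgecm-mathlib-K2Liu-p01 (g11) (= K1a desk), Track B «K2-LIT»,
#184♮ = hLiu418 = `stmt-HodgeConjecture-24832`; socket #41 ∕ #42S, KIND 1 a♮ — (K1a-T)(L2-dock) THE FRAME-vs-HEIGHT LETTERS AT THE SHIFTED FRAME
(K1a desk WORDS #25 (iii) ∕ #30 ∕ #32, 2026-09-05): the record's right frame carries the compact conjugator `g𝒦` of ★ `exists_flat_tube_presentation`
(`Frg X h w = Fr ((gc X·h)_∞ · g𝒦) w`), so the (r)(m2↑)(m2↓) letters of ★ p865050 are restated at `Fr (h_∞ · g𝒦) w` with the SAME height `‖h‖`.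
THEOREMS ONLY (no `def`, no `instance`, no notation, no named-fact hypothesis, no `sorry`).
-/
import Summits.HodgeConjecture.HodgeConjecture.Theorems.K2LiuKindOneSingularFrameHeightLetters   -- ★ p865050 (K2E4-p10 (g11)): (r)(m2↑)(m2↓) at `Fr (h_∞) w`
import HarnessLib

/-!
# Crux `HLiu418`, KIND 1 a♮ — (K1a-T)(L2-dock) `K2LiuKindOneSingularFrameHeightLettersShift`: THE (r)(m2↑)(m2↓) LETTERS AT THE SHIFTED FRAME `Fr (h_∞ · g𝒦)`

Cell `hodgecm-mathlib`, crux item hLiu418 = `stmt-HodgeConjecture-24832` (helper lane `--supports … --as helper`, count-neutral), route of record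
`HCCMUnconditional`, squad K2 ∕ K2Liu, road `K2_Liu`, socket #41 ∕ #42S, KIND 1, block K1-a♮.

WHY.  At the tie (typ4 (g4) v29∕v30 :755) the right point of the K1-a♮ ∕ block-D (C) column is framed as `Frg X h w := Fr ((gc X · h)_∞ · g𝒦) w`, where
`g𝒦` is the compact conjugator of ★ `K2LiuArchFlatTubePresentation.exists_flat_tube_presentation` (★ `exists_frameCompact_conjugator`).  Every K1-a♮ file
takes the frame `Fr` BY VALUE, so the tie instantiates them at the SHIFTED frame `Fr' x w := Fr (x · g𝒦) w` (K1a desk WORD #25); the three frame-vs-height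
letters of ★ p865050 `K2LiuKindOneSingularFrameHeightLetters` — (r) `entry_frame_le_height`, (m2↑) `im_moeb_frame_ceiling(_on)`, (m2↓)
`im_moeb_frame_floor(_on)` — are keyed to `Fr (h_∞) w`; THIS FILE restates them at `Fr (h_∞ · g𝒦) w` with the SAME adelic height `‖h‖` (the fixed
factor `Fr g𝒦 w` only changes the constants).

THE MATHEMATICS ([BorelJacquet1979, §1.2 (i), §4.1]; [Shimura1997, §6.3]).  With the frame multiplicative in the point (`hmul`, ★
`K2LiuHolTubeRigidityOfFrame.frame_mul`'s shape) one has `Fr (h_∞ · g𝒦) w = Fr (h_∞) w · Fr g𝒦 w`; the entries of `Fr (h_∞) w` are `≤ CR·‖h‖`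
(★ p865050 (r)) and those of the finitely many fixed matrices `Fr g𝒦 w` are `≤ RG` (★ `exists_entry_bound`), so the entries of the product are
`≤ 4·CR·RG·‖h‖` (§1 `entry_frame_le_height_shift`).  Since `Fr` lands in `U(J)` (`hFrU`), ★ p865050 §1 `re_star_dotProduct_im_moeb_I_mulVec_le` and
★ (m2) `re_star_dotProduct_im_moeb_I_mulVec_ge` at `R := CR'·‖h‖` give the CEILING `Re⟨v, V(Fr(h_∞·g𝒦)_w)·v⟩ ≤ CV·‖h‖²·Σ‖v_k‖²` and the FLOOR
`cV·‖h‖^(−2)·Σ‖v_k‖² ≤ Re⟨v, V(Fr(h_∞·g𝒦)_w)·v⟩` (§2), with their `∀ w' ∈ Tinf` docks `…_on` in LH4-p17's `hV0` binder shape (§3).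
CONSUMERS (tie reading, K1a desk WORD #25 (iii)): ★ p865189 `K2LiuKindOneSingularCornerTranslateCeiling.hpw_le_of_ceiling`'s `hceil` at `Fr'`;
★ p865024 `hV_twisted_of_untwistedFloor`'s `hV0` at `Fr'`; ★ p864983 `hP_of_cornerReading`'s (r) `hRw` and ★ p865128 `archLetters_of_scalarTypeGrowth_g`'s `hRw`
at `Fr'`.
HONEST LABEL.  Count-neutral helper (matrix-entry bookkeeping over ★ letters); it closes no socket: `HC_CM` is proved only modulo the 7 printed citations
(2 remaining named inputs: hLiu418 = `stmt-HodgeConjecture-24832`, h413 = `stmt-HodgeConjecture-24833`) until rung 0 closes.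

## References
* [BorelJacquet1979] A. Borel, H. Jacquet, *Automorphic forms and automorphic representations*, PSPM 33.1 (1979): §1.2 (property (i)), §4.1.
* [Shimura1997] G. Shimura, *Euler Products and Eisenstein Series*, CBMS 93 (1997): §6.3.
-/

set_option autoImplicit false
-- the mandated namespace repeats the single-problem summit's segment (`HodgeConjecture.HodgeConjecture`)
set_option linter.dupNamespace false

noncomputable section

open scoped Matrix ComplexOrder
open Complex Matrix Finset NumberField NumberField.InfinitePlace IsDedekindDomain
open Literature.NumberTheory.ModularForms.SiegelUpperHalfSpace (moeb)
open Literature.NumberTheory.Automorphic Literature.NumberTheory.Automorphic.UnitaryGroup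
open Literature.NumberTheory.GelbartRogawski1991 Literature.NumberTheory.GelbartRogawski1991.GRConstruction Literature.NumberTheory.GelbartRogawski1991.AdaptedBlocks
open Literature.NumberTheory.GelbartRogawski1991.UnitaryDualPair

namespace Summit.HodgeConjecture.HodgeConjecture.Cruxes.HLiu418.K2LiuKindOneSingularFrameHeightLettersShift

open K2LiuArchBlockHeightBound (norm_mul_apply_le)
open K2LiuArchSiegelHalfSpaceHeightBounds (re_star_dotProduct_im_moeb_I_mulVec_ge)
open K2LiuKindOneSingularFrameHeightLetters (re_star_dotProduct_im_moeb_I_mulVec_le exists_entry_bound entry_frame_le_height)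

variable (L : Type) [Field L] [NumberField L] [IsCMField L]
variable {N M : ℕ} (e : Fin N × Fin M ≃ Fin 2) (dV : Fin N → L) (hdV : ∀ i, IsCMField.complexConj L (dV i) = dV i)
  (dW : Fin M → L) (hdW : ∀ i, IsCMField.complexConj L (dW i) = dW i)

/-! ## §1 (r) at the shifted frame -/

/-- **(r) THE SHIFTED-FRAME ENTRIES AGAINST THE HEIGHT.**  For the frames of record (`hFr`, ★ `K2LiuKindWArchContinuationFramesOfRecord`'s bytes), multiplicative
in the point (`hmul`, ★ `frame_mul`'s shape), and any fixed archimedean `g𝒦`: `∃ CR ≥ 1, ∀ h w i j, ‖Fr (h_∞ · g𝒦) w i j‖ ≤ CR·‖h‖`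
(`Fr (h_∞·g𝒦) = Fr (h_∞)·Fr g𝒦`, ★ p865050 (r) for the first factor, a uniform entry bound of the fixed second factor).
[cite: BorelJacquet1979, §1.2 (property (i)), §4.1] -/
theorem entry_frame_le_height_shift (T Tinv : {w : InfinitePlace L // w.IsComplex} → Matrix (Fin 2 ⊕ Fin 2) (Fin 2 ⊕ Fin 2) ℂ)
    (Fr : UnitaryGroup.arch (Fp L) L (IsCMField.complexConj L) (2 + 2) (hermD L e dV hdV dW hdW) → {w : InfinitePlace L // w.IsComplex} →
      Matrix (Fin 2 ⊕ Fin 2) (Fin 2 ⊕ Fin 2) ℂ)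
    (hFr : ∀ a w, Fr a w = T w * Matrix.reindex (e₂ (n := 2)).symm (e₂ (n := 2)).symm
        (((UnitaryGroup.archAt (Fp L) L (IsCMField.complexConj L) (2 + 2) (hermD L e dV hdV dW hdW) w
          (UnitaryGroup.complexConj_smul_infinitePlace L w.1) (IsCMField.complexConj_ne_one L) a :
            UnitaryGroup.archLocal L (2 + 2) (hermD L e dV hdV dW hdW) w) : GL (Fin (2 + 2)) ℂ) : Matrix (Fin (2 + 2)) (Fin (2 + 2)) ℂ) * Tinv w)
    (hmul : ∀ (a b : UnitaryGroup.arch (Fp L) L (IsCMField.complexConj L) (2 + 2) (hermD L e dV hdV dW hdW)) (w : {w : InfinitePlace L // w.IsComplex}),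
      Fr (a * b) w = Fr a w * Fr b w)
    (g𝒦 : UnitaryGroup.arch (Fp L) L (IsCMField.complexConj L) (2 + 2) (hermD L e dV hdV dW hdW)) :
    ∃ CR : ℝ, 1 ≤ CR ∧ ∀ (h : HA L e dV hdV dW hdW) (w : {w : InfinitePlace L // w.IsComplex}) (i j : Fin 2 ⊕ Fin 2),
      ‖Fr (UnitaryGroup.archPart (Fp L) L (IsCMField.complexConj L) (2 + 2) (hermD L e dV hdV dW hdW) h * g𝒦) w i j‖ ≤
        CR * adelicHeightGL (2 + 2) L (h : GL (Fin (2 + 2)) (AdeleRing (𝓞 L) L)) := by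
  obtain ⟨CR, hCR1, hCR⟩ := entry_frame_le_height L e dV hdV dW hdW T Tinv Fr hFr
  obtain ⟨RG, hRG1, hRG⟩ := exists_entry_bound (fun w => Fr g𝒦 w) (fun w => Fr g𝒦 w)
  haveI : NeZero (2 + 2) := ⟨by norm_num⟩
  have hCR0 : 0 ≤ CR := zero_le_one.trans hCR1
  have hRG0 : 0 ≤ RG := zero_le_one.trans hRG1
  refine ⟨(Fintype.card (Fin 2 ⊕ Fin 2) : ℝ) * (CR * RG), ?_, fun h w i j => ?_⟩
  · simp only [Fintype.card_sum, Fintype.card_fin]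
    push_cast
    nlinarith
  · set H : ℝ := adelicHeightGL (2 + 2) L (h : GL (Fin (2 + 2)) (AdeleRing (𝓞 L) L)) with hHdef
    have hH0 : 0 ≤ H := adelicHeightGL_nonneg _
    rw [hmul]
    calc _ ≤ (Fintype.card (Fin 2 ⊕ Fin 2) : ℝ) * (CR * H * RG) :=
          norm_mul_apply_le (by positivity) (fun i j => hCR h w i j) (fun i j => (hRG w i j).1) i j
      _ = (Fintype.card (Fin 2 ⊕ Fin 2) : ℝ) * (CR * RG) * H := by ring

/-! ## §2 (m2↑)(m2↓) at the shifted frame -/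

/-- **(m2↑) THE CEILING AT THE SHIFTED FRAMES**: `∃ CV ≥ 0, ∀ h w v, Re⟨v, V(Fr(h_∞·g𝒦)_w)·v⟩ ≤ CV·‖h‖²·Σ_k ‖v_k‖²` (★ p865050 §1 at `R := CR·‖h‖` with §1's
`CR`; `hFrU`: the frames are `J`-unitary). [cite: Shimura1997, §6.3] [cite: BorelJacquet1979, §1.2, §4.1] -/
theorem im_moeb_frame_ceiling_shift (T Tinv : {w : InfinitePlace L // w.IsComplex} → Matrix (Fin 2 ⊕ Fin 2) (Fin 2 ⊕ Fin 2) ℂ)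
    (Fr : UnitaryGroup.arch (Fp L) L (IsCMField.complexConj L) (2 + 2) (hermD L e dV hdV dW hdW) → {w : InfinitePlace L // w.IsComplex} →
      Matrix (Fin 2 ⊕ Fin 2) (Fin 2 ⊕ Fin 2) ℂ)
    (hFr : ∀ a w, Fr a w = T w * Matrix.reindex (e₂ (n := 2)).symm (e₂ (n := 2)).symm
        (((UnitaryGroup.archAt (Fp L) L (IsCMField.complexConj L) (2 + 2) (hermD L e dV hdV dW hdW) w
          (UnitaryGroup.complexConj_smul_infinitePlace L w.1) (IsCMField.complexConj_ne_one L) a :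
            UnitaryGroup.archLocal L (2 + 2) (hermD L e dV hdV dW hdW) w) : GL (Fin (2 + 2)) ℂ) : Matrix (Fin (2 + 2)) (Fin (2 + 2)) ℂ) * Tinv w)
    (hmul : ∀ (a b : UnitaryGroup.arch (Fp L) L (IsCMField.complexConj L) (2 + 2) (hermD L e dV hdV dW hdW)) (w : {w : InfinitePlace L // w.IsComplex}),
      Fr (a * b) w = Fr a w * Fr b w)
    (hFrU : ∀ (a : UnitaryGroup.arch (Fp L) L (IsCMField.complexConj L) (2 + 2) (hermD L e dV hdV dW hdW)) (w : {w : InfinitePlace L // w.IsComplex}),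
      (Fr a w)ᴴ * Matrix.J (Fin 2) ℂ * Fr a w = Matrix.J (Fin 2) ℂ)
    (g𝒦 : UnitaryGroup.arch (Fp L) L (IsCMField.complexConj L) (2 + 2) (hermD L e dV hdV dW hdW)) :
    ∃ CV : ℝ, 0 ≤ CV ∧ ∀ (h : HA L e dV hdV dW hdW) (w : {w : InfinitePlace L // w.IsComplex}) (v : Fin 2 → ℂ),
      (star v ⬝ᵥ (((2 * I)⁻¹ • (moeb (Fr (UnitaryGroup.archPart (Fp L) L (IsCMField.complexConj L) (2 + 2) (hermD L e dV hdV dW hdW) h * g𝒦) w) (I • (1 : Matrix (Fin 2) (Fin 2) ℂ)) -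
          (moeb (Fr (UnitaryGroup.archPart (Fp L) L (IsCMField.complexConj L) (2 + 2) (hermD L e dV hdV dW hdW) h * g𝒦) w) (I • (1 : Matrix (Fin 2) (Fin 2) ℂ)))ᴴ)) *ᵥ v)).re ≤
        CV * adelicHeightGL (2 + 2) L (h : GL (Fin (2 + 2)) (AdeleRing (𝓞 L) L)) ^ 2 * ∑ k, ‖v k‖ ^ 2 := by
  obtain ⟨CR, hCR1, hCR⟩ := entry_frame_le_height_shift L e dV hdV dW hdW T Tinv Fr hFr hmul g𝒦
  refine ⟨2 * (2 * (2 * 2 * CR) ^ 2), by positivity, fun h w v => ?_⟩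
  have hb := re_star_dotProduct_im_moeb_I_mulVec_le (hFrU _ w) (fun i j => hCR h w i j) v
  rw [Fintype.card_fin] at hb
  refine hb.trans (le_of_eq ?_)
  push_cast
  ring

/-- **(m2↓) THE FLOOR AT THE SHIFTED FRAMES** (★ (m2) `re_star_dotProduct_im_moeb_I_mulVec_ge` at `R := CR·‖h‖`): `∃ cV > 0, ∀ h w v,
cV·‖h‖^(−2)·Σ_k ‖v_k‖² ≤ Re⟨v, V(Fr(h_∞·g𝒦)_w)·v⟩` (`cV = (4·CR)⁻²`). [cite: Shimura1997, §6.3] [cite: BorelJacquet1979, §1.2, §4.1] -/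
theorem im_moeb_frame_floor_shift (T Tinv : {w : InfinitePlace L // w.IsComplex} → Matrix (Fin 2 ⊕ Fin 2) (Fin 2 ⊕ Fin 2) ℂ)
    (Fr : UnitaryGroup.arch (Fp L) L (IsCMField.complexConj L) (2 + 2) (hermD L e dV hdV dW hdW) → {w : InfinitePlace L // w.IsComplex} →
      Matrix (Fin 2 ⊕ Fin 2) (Fin 2 ⊕ Fin 2) ℂ)
    (hFr : ∀ a w, Fr a w = T w * Matrix.reindex (e₂ (n := 2)).symm (e₂ (n := 2)).symm
        (((UnitaryGroup.archAt (Fp L) L (IsCMField.complexConj L) (2 + 2) (hermD L e dV hdV dW hdW) w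
          (UnitaryGroup.complexConj_smul_infinitePlace L w.1) (IsCMField.complexConj_ne_one L) a :
            UnitaryGroup.archLocal L (2 + 2) (hermD L e dV hdV dW hdW) w) : GL (Fin (2 + 2)) ℂ) : Matrix (Fin (2 + 2)) (Fin (2 + 2)) ℂ) * Tinv w)
    (hmul : ∀ (a b : UnitaryGroup.arch (Fp L) L (IsCMField.complexConj L) (2 + 2) (hermD L e dV hdV dW hdW)) (w : {w : InfinitePlace L // w.IsComplex}),
      Fr (a * b) w = Fr a w * Fr b w)
    (hFrU : ∀ (a : UnitaryGroup.arch (Fp L) L (IsCMField.complexConj L) (2 + 2) (hermD L e dV hdV dW hdW)) (w : {w : InfinitePlace L // w.IsComplex}),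
      (Fr a w)ᴴ * Matrix.J (Fin 2) ℂ * Fr a w = Matrix.J (Fin 2) ℂ)
    (g𝒦 : UnitaryGroup.arch (Fp L) L (IsCMField.complexConj L) (2 + 2) (hermD L e dV hdV dW hdW)) :
    ∃ cV : ℝ, 0 < cV ∧ ∀ (h : HA L e dV hdV dW hdW) (w : {w : InfinitePlace L // w.IsComplex}) (v : Fin 2 → ℂ),
      cV * adelicHeightGL (2 + 2) L (h : GL (Fin (2 + 2)) (AdeleRing (𝓞 L) L)) ^ (-(2 : ℝ)) * ∑ k, ‖v k‖ ^ 2 ≤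
        (star v ⬝ᵥ (((2 * I)⁻¹ • (moeb (Fr (UnitaryGroup.archPart (Fp L) L (IsCMField.complexConj L) (2 + 2) (hermD L e dV hdV dW hdW) h * g𝒦) w) (I • (1 : Matrix (Fin 2) (Fin 2) ℂ)) -
          (moeb (Fr (UnitaryGroup.archPart (Fp L) L (IsCMField.complexConj L) (2 + 2) (hermD L e dV hdV dW hdW) h * g𝒦) w) (I • (1 : Matrix (Fin 2) (Fin 2) ℂ)))ᴴ)) *ᵥ v)).re := by
  obtain ⟨CR, hCR1, hCR⟩ := entry_frame_le_height_shift L e dV hdV dW hdW T Tinv Fr hFr hmul g𝒦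
  refine ⟨((2 * (2 * CR)) ^ 2)⁻¹, by positivity, fun h w v => ?_⟩
  have hH0 : 0 ≤ adelicHeightGL (2 + 2) L (h : GL (Fin (2 + 2)) (AdeleRing (𝓞 L) L)) := adelicHeightGL_nonneg _
  have hb := re_star_dotProduct_im_moeb_I_mulVec_ge (hFrU _ w) (fun i j => hCR h w i j) v
  rw [Fintype.card_fin] at hb
  refine le_trans (le_of_eq ?_) hb
  rw [Real.rpow_neg hH0, Real.rpow_two]
  push_cast
  ring

/-! ## §3 The `∀ w' ∈ Tinf` docks -/

/-- **(m2↑) at the shifted frames on a place set**, in LH4-p17's `hV0` ∕ ★ p865189's `hceil` binder shape (`∀ h, ∀ w' ∈ Tinf, ∀ v`, the complex place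
`⟨w', IsTotallyComplex.isComplex w'⟩`). [cite: Shimura1997, §6.3] -/
theorem im_moeb_frame_ceiling_on_shift (Tinf : Finset (InfinitePlace L)) (T Tinv : {w : InfinitePlace L // w.IsComplex} → Matrix (Fin 2 ⊕ Fin 2) (Fin 2 ⊕ Fin 2) ℂ)
    (Fr : UnitaryGroup.arch (Fp L) L (IsCMField.complexConj L) (2 + 2) (hermD L e dV hdV dW hdW) → {w : InfinitePlace L // w.IsComplex} →
      Matrix (Fin 2 ⊕ Fin 2) (Fin 2 ⊕ Fin 2) ℂ)
    (hFr : ∀ a w, Fr a w = T w * Matrix.reindex (e₂ (n := 2)).symm (e₂ (n := 2)).symm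
        (((UnitaryGroup.archAt (Fp L) L (IsCMField.complexConj L) (2 + 2) (hermD L e dV hdV dW hdW) w
          (UnitaryGroup.complexConj_smul_infinitePlace L w.1) (IsCMField.complexConj_ne_one L) a :
            UnitaryGroup.archLocal L (2 + 2) (hermD L e dV hdV dW hdW) w) : GL (Fin (2 + 2)) ℂ) : Matrix (Fin (2 + 2)) (Fin (2 + 2)) ℂ) * Tinv w)
    (hmul : ∀ (a b : UnitaryGroup.arch (Fp L) L (IsCMField.complexConj L) (2 + 2) (hermD L e dV hdV dW hdW)) (w : {w : InfinitePlace L // w.IsComplex}),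
      Fr (a * b) w = Fr a w * Fr b w)
    (hFrU : ∀ (a : UnitaryGroup.arch (Fp L) L (IsCMField.complexConj L) (2 + 2) (hermD L e dV hdV dW hdW)) (w : {w : InfinitePlace L // w.IsComplex}),
      (Fr a w)ᴴ * Matrix.J (Fin 2) ℂ * Fr a w = Matrix.J (Fin 2) ℂ)
    (g𝒦 : UnitaryGroup.arch (Fp L) L (IsCMField.complexConj L) (2 + 2) (hermD L e dV hdV dW hdW)) :
    ∃ CV : ℝ, 0 ≤ CV ∧ ∀ (h : HA L e dV hdV dW hdW), ∀ w' ∈ Tinf, ∀ v : Fin 2 → ℂ,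
      (star v ⬝ᵥ (((2 * I)⁻¹ • (moeb (Fr (UnitaryGroup.archPart (Fp L) L (IsCMField.complexConj L) (2 + 2) (hermD L e dV hdV dW hdW) h * g𝒦) ⟨w', IsTotallyComplex.isComplex w'⟩)
            (I • (1 : Matrix (Fin 2) (Fin 2) ℂ)) -
          (moeb (Fr (UnitaryGroup.archPart (Fp L) L (IsCMField.complexConj L) (2 + 2) (hermD L e dV hdV dW hdW) h * g𝒦) ⟨w', IsTotallyComplex.isComplex w'⟩)
            (I • (1 : Matrix (Fin 2) (Fin 2) ℂ)))ᴴ)) *ᵥ v)).re ≤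
        CV * adelicHeightGL (2 + 2) L (h : GL (Fin (2 + 2)) (AdeleRing (𝓞 L) L)) ^ 2 * ∑ k, ‖v k‖ ^ 2 := by
  obtain ⟨CV, hCV, h⟩ := im_moeb_frame_ceiling_shift L e dV hdV dW hdW T Tinv Fr hFr hmul hFrU g𝒦
  exact ⟨CV, hCV, fun h' w' _ v => h h' ⟨w', IsTotallyComplex.isComplex w'⟩ v⟩

/-- **(m2↓) at the shifted frames on a place set**, in LH4-p17's `hV0` binder shape with `ρ h := ‖h‖ ^ (-(2 : ℝ))` (`∀ h, ∀ w' ∈ Tinf, ∀ v`).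
[cite: Shimura1997, §6.3] -/
theorem im_moeb_frame_floor_on_shift (Tinf : Finset (InfinitePlace L)) (T Tinv : {w : InfinitePlace L // w.IsComplex} → Matrix (Fin 2 ⊕ Fin 2) (Fin 2 ⊕ Fin 2) ℂ)
    (Fr : UnitaryGroup.arch (Fp L) L (IsCMField.complexConj L) (2 + 2) (hermD L e dV hdV dW hdW) → {w : InfinitePlace L // w.IsComplex} →
      Matrix (Fin 2 ⊕ Fin 2) (Fin 2 ⊕ Fin 2) ℂ)
    (hFr : ∀ a w, Fr a w = T w * Matrix.reindex (e₂ (n := 2)).symm (e₂ (n := 2)).symm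
        (((UnitaryGroup.archAt (Fp L) L (IsCMField.complexConj L) (2 + 2) (hermD L e dV hdV dW hdW) w
          (UnitaryGroup.complexConj_smul_infinitePlace L w.1) (IsCMField.complexConj_ne_one L) a :
            UnitaryGroup.archLocal L (2 + 2) (hermD L e dV hdV dW hdW) w) : GL (Fin (2 + 2)) ℂ) : Matrix (Fin (2 + 2)) (Fin (2 + 2)) ℂ) * Tinv w)
    (hmul : ∀ (a b : UnitaryGroup.arch (Fp L) L (IsCMField.complexConj L) (2 + 2) (hermD L e dV hdV dW hdW)) (w : {w : InfinitePlace L // w.IsComplex}),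
      Fr (a * b) w = Fr a w * Fr b w)
    (hFrU : ∀ (a : UnitaryGroup.arch (Fp L) L (IsCMField.complexConj L) (2 + 2) (hermD L e dV hdV dW hdW)) (w : {w : InfinitePlace L // w.IsComplex}),
      (Fr a w)ᴴ * Matrix.J (Fin 2) ℂ * Fr a w = Matrix.J (Fin 2) ℂ)
    (g𝒦 : UnitaryGroup.arch (Fp L) L (IsCMField.complexConj L) (2 + 2) (hermD L e dV hdV dW hdW)) :
    ∃ cV : ℝ, 0 < cV ∧ ∀ (h : HA L e dV hdV dW hdW), ∀ w' ∈ Tinf, ∀ v : Fin 2 → ℂ,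
      cV * adelicHeightGL (2 + 2) L (h : GL (Fin (2 + 2)) (AdeleRing (𝓞 L) L)) ^ (-(2 : ℝ)) * ∑ k, ‖v k‖ ^ 2 ≤
        (star v ⬝ᵥ (((2 * I)⁻¹ • (moeb (Fr (UnitaryGroup.archPart (Fp L) L (IsCMField.complexConj L) (2 + 2) (hermD L e dV hdV dW hdW) h * g𝒦) ⟨w', IsTotallyComplex.isComplex w'⟩)
            (I • (1 : Matrix (Fin 2) (Fin 2) ℂ)) -
          (moeb (Fr (UnitaryGroup.archPart (Fp L) L (IsCMField.complexConj L) (2 + 2) (hermD L e dV hdV dW hdW) h * g𝒦) ⟨w', IsTotallyComplex.isComplex w'⟩)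
            (I • (1 : Matrix (Fin 2) (Fin 2) ℂ)))ᴴ)) *ᵥ v)).re := by
  obtain ⟨cV, hcV, h⟩ := im_moeb_frame_floor_shift L e dV hdV dW hdW T Tinv Fr hFr hmul hFrU g𝒦
  exact ⟨cV, hcV, fun h' w' _ v => h h' ⟨w', IsTotallyComplex.isComplex w'⟩ v⟩

end Summit.HodgeConjecture.HodgeConjecture.Cruxes.HLiu418.K2LiuKindOneSingularFrameHeightLettersShift

end
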